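import Literature.Probability.LatticeModels.RotatedTorusLayers
import HarnessLib

/-!
# The diagonal Fourier modes of the rotated torus: spectral profile and monotonicity (ADC Prop. 5.4 (iii), finite volume)

Topic `Literature/Probability/LatticeModels`; family `crit-ising`. No named fact, no sorry.

Aizenman–Duminil-Copin 2021, Prop. 5.4, third item (arXiv:1912.07973 p. 18; Panis 2023, Prop. 3.16):
`Ŝ^{mod}_β(p) = Ŝ_β(p) + Ŝ_β(p + π(1,1,0,…))` is monotone along anti-diagonals. Their proof: on the
partially rotated periodic box the transfer matrix in the direction `e₀ + e₁`, adding alternately a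
layer of odd and a layer of even vertices, restricts on the even vertices to the positive matrix
`TT*`, "we conclude as before" (i.e. by the spectral argument of Prop. 5.4 (i)).

This file proves the exact finite-volume statement on the rotated torus of `RotatedTorus` /
`RotatedTorusLayers`. With `E = {(2m, w)} ≅ ℤ/Nℤ × (ℤ/Nℤ)^{d''+1}` the even sublattice in the
pulled-back coordinates `(m, v) ↦ (2m, v + m e_b)` and its characters `Θ(m,v) = e(κm)χ_{k⊥}(v)`:

* `rotDiagFourier β h κ k⊥ = D_N(κ, k⊥) = ∑_{(m,v)} ⟨σ₀ σ_{(2m, v+me_b)}⟩ conj Θ(m,v)` — the Fourier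
  transform of the two-point function restricted to `E`;
* `card_mul_Z_mul_rotDiagFourierH` — square completion `|E| Z D_N = ∑_σ e^{-βH}|Φ|²`,
  `Φ = ∑_m e(κm)Ψ_m`, `Ψ_m = ∑_v χ_{k⊥}(v) R_m(v)` (`evenMode`);
* `cardLayer_mul_Z_mul_rotDiagFourierH` — stationarity along the diagonal (the translation by
  `π(e₀+e₁) = (2, e_b)` is an automorphism shifting `m`): `N^{d''+1} Z D_N = ∑_n e(κn) ∑_σ e^{-βH} Ψ_n conj Ψ_0`;
* `sum_rotWeight_evenMode_conj_eq_trace` — the layer correlations are two-insertion traces of the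
  positive semidefinite symmetrised two-step matrix `A` of `RotatedTorusLayers`;
* `exists_rotSpectralProfile` — hence `N^{d''+1} Z D_N(κ,k⊥) = ρ(1 - cos(2πκ/N))` with `ρ ≥ 0`
  non-increasing (`TorusTransferSpectral.sum_pow_mul_spectralSum_eq`, `pairKernel_antitone`);
* `rotDiagFourier_re_nonneg`, **`rotDiagFourier_re_le_of_cos_le`** — `D_N ≥ 0` and `D_N(κ', k⊥) ≤
  D_N(κ, k⊥)` whenever `cos(2πκ'/N) ≤ cos(2πκ/N)`: ADC Prop. 5.4 (iii) in finite volume.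

Lattice dictionary (for the sequel, where `N → ∞`): a site `(2m, v + me_b) = π(x)` has
`x₀ + x₁ = 2m`, `x₁ = v₀ + m`, so `p·x = (p₀+p₁)m + (p₁−p₀)v₀ + p'·z`; the diagonal frequency `κ` is dual
to `p₀ + p₁` and `k⊥₀` to `p₁ − p₀`; the sum over `E` of `S(x)e^{-ip·x}` tends to
`½[Ŝ(p) + Ŝ(p + π(1,1,0,…))] = ½ Ŝ^{mod}(p)`.

## References

* M. Aizenman, H. Duminil-Copin, Ann. of Math. 194 (2021) = arXiv:1912.07973, proof of Prop. 5.4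
  (iii) (p. 18) [AizenmanDuminilCopinAnnals2021]; R. Panis, arXiv:2309.05797, Prop. 3.16 [Panis2023Triviality].
* T. D. Schultz, D. C. Mattis, E. H. Lieb, Rev. Mod. Phys. 36 (1964), §II [SchultzMattisLieb1964].
* S. Friedli, Y. Velenik (2017), §10.5.2 [FriedliVelenik2017].
-/

noncomputable section

open MeasureTheory Filter Topology Finset Matrix Complex
open scoped ComplexConjugate

namespace Literature.Probability.LatticeModels

variable {d'' N : ℕ} [NeZero N]

/-! ### Part F. The even-sublattice Fourier transform and its square completion -/

section Fourier

/-- The periodic Gibbs weight `e^{-βH(σ)}` of the rotated torus. [cite: AizenmanDuminilCopinAnnals2021, arXiv:1912.07973 proof of Prop. 5.4 (iii) (p. 18)] -/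
def rotWeight (β h : ℝ) (σ : SpinConfig (RotSite d'' N)) : ℝ :=
  Real.exp (-β * isingHamiltonian (rotGraph d'' N) Finset.univ h .free σ)

/-- The field-`h` version of the two-point function used in the weight identities (at `h = 0` it is
`rotTwoPoint`). [folklore] -/
def rotTwoPointH (β h : ℝ) (u v : RotSite d'' N) : ℝ := isingTwoPoint (rotGraph d'' N) Finset.univ β h .free u v

/-- At `h = 0` this is `rotTwoPoint`. [folklore] -/
theorem rotTwoPointH_zero (β : ℝ) (u v : RotSite d'' N) : rotTwoPointH β 0 u v = rotTwoPoint d'' N β u v := rfl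

/-- **The diagonal Fourier transform of the two-point function over the even sublattice**
`E = {(2m, w)} ≅ ℤ/Nℤ × (ℤ/Nℤ)^{d''+1}` of the rotated torus, in the pulled-back coordinates
`(m, v) ↦ (2m, v + m e_b)` (a group isomorphism `ℤ/Nℤ × (ℤ/Nℤ)^{d''+1} → E`):
`D_N(κ, k⊥) = ∑_{m,v} ⟨σ₀σ_{(2m, v + m e_b)}⟩^{rot}_{β,h} · conj(e(κm) χ_{k⊥}(v))` (any field `h`; at `h = 0`
the two-point function is `rotTwoPoint`). The "time" frequency
`κ` is dual to `x₀ + x₁`, `k⊥₀` to `x₁ − x₀` (see the sequel for the dictionary). [cite: AizenmanDuminilCopinAnnals2021, arXiv:1912.07973 proof of Prop. 5.4 (iii) (p. 18)] -/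
def rotDiagFourier (β h : ℝ) (κ : ZMod N) (kp : TorusSite (d'' + 1) N) : ℂ :=
  ∑ m : ZMod N, ∑ v : TorusSite (d'' + 1) N,
    (rotTwoPointH β h 0 (twoMul m, v + layerShift m) : ℂ) * conj (ZMod.stdAddChar (κ * m) * torusChar kp v)

/-- The **even-layer spin-wave mode** `Ψ_m(σ) = ∑_v χ_{k⊥}(v) R_m(σ)(v)`. [cite: AizenmanDuminilCopinAnnals2021, arXiv:1912.07973 proof of Prop. 5.4 (iii) (p. 18)] -/
def evenMode (kp : TorusSite (d'' + 1) N) (σ : SpinConfig (RotSite d'' N)) (m : ZMod N) : ℂ :=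
  ∑ v : TorusSite (d'' + 1) N, torusChar kp v * (spinAt v (evenLayer σ m) : ℂ)

/-- The translation by the even-sublattice element `(2t, t e_b) = π(t(e₀+e₁))`. [folklore] -/
def evenShift (t : ZMod N) : RotSite d'' N := (twoMul t, layerShift t)

/-- The even layers of a diagonally translated configuration: `R_m(σ ∘ τ_t) = R_{m+t}(σ)`. [folklore] -/
theorem evenLayer_comp_addRight (σ : SpinConfig (RotSite d'' N)) (m t : ZMod N) :
    evenLayer (σ ∘ Equiv.addRight (evenShift (d'' := d'') t)) m = evenLayer σ (m + t) := by
  funext w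
  simp only [evenLayer, Function.comp_apply, Equiv.coe_addRight, evenShift, Prod.mk_add_mk, twoMul_add,
    layerShift_add]
  congr 2
  abel

/-- `Ψ_m(σ ∘ τ_t) = Ψ_{m+t}(σ)`. [folklore] -/
theorem evenMode_comp_addRight (kp : TorusSite (d'' + 1) N) (σ : SpinConfig (RotSite d'' N)) (m t : ZMod N) :
    evenMode kp (σ ∘ Equiv.addRight (evenShift (d'' := d'') t)) m = evenMode kp σ (m + t) := by
  unfold evenMode
  rw [evenLayer_comp_addRight]

/-- **Invariance of weighted configuration sums under automorphisms of the rotated torus.** [cite: FriedliVelenik2017, §10.3.1 eq. (10.2)] -/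
theorem sum_rotWeight_mul_comp_equiv (β h : ℝ) (θ : RotSite d'' N ≃ RotSite d'' N)
    (hθ : ∀ x y, (rotGraph d'' N).Adj (θ x) (θ y) ↔ (rotGraph d'' N).Adj x y)
    (F : SpinConfig (RotSite d'' N) → ℂ) :
    ∑ σ : SpinConfig (RotSite d'' N), (rotWeight β h σ : ℂ) * F (σ ∘ θ) =
      ∑ σ : SpinConfig (RotSite d'' N), (rotWeight β h σ : ℂ) * F σ := by
  have hw : ∀ σ : SpinConfig (RotSite d'' N), rotWeight β h (σ ∘ θ) = rotWeight β h σ := by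
    intro σ
    simp only [rotWeight, isingHamiltonian_univ_free_comp_equiv _ θ hθ]
  calc ∑ σ : SpinConfig (RotSite d'' N), (rotWeight β h σ : ℂ) * F (σ ∘ θ)
      = ∑ σ : SpinConfig (RotSite d'' N), (rotWeight β h (σ ∘ θ) : ℂ) * F (σ ∘ θ) := by simp only [hw]
    _ = ∑ σ : SpinConfig (RotSite d'' N), (rotWeight β h σ : ℂ) * F σ :=
        Equiv.sum_comp (Equiv.arrowCongr θ.symm (Equiv.refl ℤˣ)) (fun σ => (rotWeight β h σ : ℂ) * F σ)

/-- **Stationarity along the diagonal**: `∑_σ w Ψ_s conj Ψ_t = ∑_σ w Ψ_{s-t} conj Ψ_0`. [folklore] -/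
theorem sum_rotWeight_evenMode_mul_conj (β h : ℝ) (kp : TorusSite (d'' + 1) N) (s t : ZMod N) :
    ∑ σ : SpinConfig (RotSite d'' N), (rotWeight β h σ : ℂ) * (evenMode kp σ s * conj (evenMode kp σ t)) =
      ∑ σ : SpinConfig (RotSite d'' N), (rotWeight β h σ : ℂ) * (evenMode kp σ (s - t) * conj (evenMode kp σ 0)) := by
  rw [← sum_rotWeight_mul_comp_equiv β h (Equiv.addRight (evenShift (d'' := d'') (-t)))
    (fun x y => rotGraph_adj_add_right _ x y)]
  refine Finset.sum_congr rfl fun σ _ => ?_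
  simp only [evenMode_comp_addRight, ← sub_eq_add_neg, sub_self]

/-- The pair correlation as a weighted configuration sum: `Z ⟨σ_uσ_{u'}⟩ = ∑_σ w σ_u σ_{u'}`. [folklore] -/
theorem sum_rotWeight_mul_spin_mul_spin (β h : ℝ) (u u' : RotSite d'' N) :
    ∑ σ : SpinConfig (RotSite d'' N), (rotWeight β h σ : ℂ) * ((spinAt u σ : ℂ) * (spinAt u' σ : ℂ)) =
      (isingPartitionFunction (rotGraph d'' N) Finset.univ β h .free : ℂ) * (rotTwoPointH β h u u' : ℂ) := by
  classical
  have hZpos : 0 < isingPartitionFunction (rotGraph d'' N) Finset.univ β h .free := isingPartitionFunction_pos _ _ β h _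
  have hZ0 : (isingPartitionFunction (rotGraph d'' N) Finset.univ β h .free : ℂ) ≠ 0 := by exact_mod_cast hZpos.ne'
  have htwo : (rotTwoPointH β h u u' : ℂ) = (isingPartitionFunction (rotGraph d'' N) Finset.univ β h .free : ℂ)⁻¹ *
      ∑ σ : SpinConfig (RotSite d'' N), (rotWeight β h σ : ℂ) * ((spinAt u σ : ℂ) * (spinAt u' σ : ℂ)) := by
    rw [rotTwoPointH, isingTwoPoint, isingExpect, ← integral_complex_ofReal]
    change ∫ σ, ((spinPair u u' σ : ℝ) : ℂ) ∂(isingMeasure (rotGraph d'' N) Finset.univ β h .free) = _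
    rw [integral_isingMeasure_univ_free, Finset.smul_sum]
    simp only [Complex.real_smul, Complex.ofReal_inv, Finset.mul_sum, rotWeight, spinPair, Complex.ofReal_mul]
  rw [htwo, ← mul_assoc, mul_inv_cancel₀ hZ0, one_mul]

/-- Translation invariance of the field-`h` two-point function. [cite: FriedliVelenik2017, §3.1] -/
theorem rotTwoPointH_eq_zero_sub (β h : ℝ) (u u' : RotSite d'' N) :
    rotTwoPointH β h u u' = rotTwoPointH β h 0 (u' - u) := by
  have key := isingExpect_free_univ_comp (G := rotGraph d'' N) (Equiv.addRight (-u))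
    (rotGraph_adj_add_right (-u)) β h (measurable_spinPair (u + -u) (u' + -u))
  have hobs : (fun σ : SpinConfig (RotSite d'' N) => spinPair (u + -u) (u' + -u) (σ ∘ (Equiv.addRight (-u)).symm)) =
      spinPair u u' := by
    funext σ
    simp [spinPair, spinAt]
  rw [hobs] at key
  rw [rotTwoPointH, rotTwoPointH, isingTwoPoint, isingTwoPoint, key, add_neg_cancel, ← sub_eq_add_neg]

/-- Differences of even-sublattice sites in pulled-back coordinates. [folklore] -/
theorem evenSite_sub (m m' : ZMod N) (v v' : TorusSite (d'' + 1) N) :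
    ((twoMul m', v' + layerShift m') : RotSite d'' N) - (twoMul m, v + layerShift m) =
      (twoMul (m' - m), (v' - v) + layerShift (m' - m)) := by
  have h1 : twoMul m' = twoMul (m' - m) + twoMul m := by rw [← twoMul_add, sub_add_cancel]
  have h2 : (layerShift m' : TorusSite (d'' + 1) N) = layerShift (m' - m) + layerShift m := by
    rw [← layerShift_add, sub_add_cancel]
  rw [Prod.mk_sub_mk, h1, h2]
  congr 1
  · abel
  · abel

/-- The character of the even sublattice in pulled-back coordinates, `Θ(m, v) = e(κm) χ_{k⊥}(v)`. [folklore] -/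
def evenChar (κ : ZMod N) (kp : TorusSite (d'' + 1) N) (q : ZMod N × TorusSite (d'' + 1) N) : ℂ :=
  ZMod.stdAddChar (κ * q.1) * torusChar kp q.2

/-- The even site with pulled-back coordinates `(m, v)`: `(2m, v + m e_b)`. [folklore] -/
def evenSite (q : ZMod N × TorusSite (d'' + 1) N) : RotSite d'' N := (twoMul q.1, q.2 + layerShift q.1)

/-- `Θ` is multiplicative. [folklore] -/
theorem evenChar_add (κ : ZMod N) (kp : TorusSite (d'' + 1) N) (q r : ZMod N × TorusSite (d'' + 1) N) :
    evenChar κ kp (q + r) = evenChar κ kp q * evenChar κ kp r := by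
  simp only [evenChar, Prod.fst_add, Prod.snd_add, mul_add, AddChar.map_add_eq_mul, torusChar_add_right]
  ring

/-- `Θ conj Θ = 1`. [folklore] -/
theorem evenChar_mul_conj (κ : ZMod N) (kp : TorusSite (d'' + 1) N) (q : ZMod N × TorusSite (d'' + 1) N) :
    evenChar κ kp q * conj (evenChar κ kp q) = 1 := by
  rw [mul_conj, Complex.normSq_eq_norm_sq, evenChar, norm_mul, norm_stdAddChar, norm_torusChar]
  simp

/-- Differences of even sites: `evenSite q' - evenSite q = evenSite (q' - q)`. [folklore] -/
theorem evenSite_sub_evenSite (q q' : ZMod N × TorusSite (d'' + 1) N) :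
    (evenSite q' : RotSite d'' N) - evenSite q = evenSite (q' - q) := by
  simp only [evenSite, Prod.fst_sub, Prod.snd_sub]
  exact evenSite_sub q.1 q'.1 q.2 q'.2

/-- `D_N` as a sum over the product coordinates. [folklore] -/
theorem rotDiagFourier_eq_sum_prod (β h : ℝ) (κ : ZMod N) (kp : TorusSite (d'' + 1) N) :
    rotDiagFourier (d'' := d'') β h κ kp = ∑ q : ZMod N × TorusSite (d'' + 1) N,
      (rotTwoPointH β h 0 (evenSite q) : ℂ) * conj (evenChar κ kp q) := by
  rw [rotDiagFourier, Fintype.sum_prod_type]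
  rfl

/-- `Φ(σ) = ∑_m e(κm)Ψ_m(σ) = ∑_q Θ(q) σ_{evenSite q}`. [folklore] -/
theorem sum_stdAddChar_mul_evenMode_eq (κ : ZMod N) (kp : TorusSite (d'' + 1) N) (σ : SpinConfig (RotSite d'' N)) :
    ∑ m : ZMod N, ZMod.stdAddChar (κ * m) * evenMode kp σ m =
      ∑ q : ZMod N × TorusSite (d'' + 1) N, evenChar κ kp q * (spinAt (evenSite q) σ : ℂ) := by
  rw [Fintype.sum_prod_type]
  refine Finset.sum_congr rfl fun m _ => ?_
  rw [evenMode, Finset.mul_sum]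
  refine Finset.sum_congr rfl fun v _ => ?_
  rw [evenChar, evenSite, spinAt_even]
  ring

/-- **Square completion on the even sublattice** (Friedli–Velenik 2017, §10.5.2, "by translation
invariance `∑_j e^{ip·j}⟨S₀·S_j⟩ = ⟨‖Ŝ_p‖²⟩`", here for the subgroup `E ≅ ℤ/Nℤ × (ℤ/Nℤ)^{d''+1}` and
its character `Θ(m, v) = e(κm)χ_{k⊥}(v)`): with `Φ(σ) = ∑_m e(κm) Ψ_m(σ)`,
`|E| · Z · D_N^{(h)}(κ, k⊥) = ∑_σ e^{-βH(σ)} |Φ(σ)|²`. [cite: FriedliVelenik2017, §10.5.2 (display before (10.40))] -/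
theorem card_mul_Z_mul_rotDiagFourierH (β h : ℝ) (κ : ZMod N) (kp : TorusSite (d'' + 1) N) :
    ((Fintype.card (ZMod N × TorusSite (d'' + 1) N) : ℂ) *
        (isingPartitionFunction (rotGraph d'' N) Finset.univ β h .free : ℂ)) *
      rotDiagFourier (d'' := d'') β h κ kp =
    ∑ σ : SpinConfig (RotSite d'' N), (rotWeight β h σ : ℂ) *
      ((∑ m : ZMod N, ZMod.stdAddChar (κ * m) * evenMode kp σ m) * conj (∑ m : ZMod N, ZMod.stdAddChar (κ * m) * evenMode kp σ m)) := by
  classical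
  set Q := ZMod N × TorusSite (d'' + 1) N
  set Z := (isingPartitionFunction (rotGraph d'' N) Finset.univ β h .free : ℂ) with hZ
  simp only [sum_stdAddChar_mul_evenMode_eq, rotDiagFourier_eq_sum_prod]
  -- `|E| D = ∑_{q,q'} G(0, evenSite(q' - q)) Θ(q) conj Θ(q')`
  have hsum : (Fintype.card Q : ℂ) * ∑ r : Q, (rotTwoPointH β h 0 (evenSite r) : ℂ) * conj (evenChar κ kp r) =
      ∑ q : Q, ∑ q' : Q, (rotTwoPointH β h 0 (evenSite (q' - q)) : ℂ) * (evenChar κ kp q * conj (evenChar κ kp q')) := by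
    have : ∀ q : Q, ∑ q' : Q, (rotTwoPointH β h 0 (evenSite (q' - q)) : ℂ) * (evenChar κ kp q * conj (evenChar κ kp q')) =
        ∑ r : Q, (rotTwoPointH β h 0 (evenSite r) : ℂ) * conj (evenChar κ kp r) := by
      intro q
      rw [← Equiv.sum_comp (Equiv.addRight q)]
      refine Finset.sum_congr rfl fun r _ => ?_
      simp only [Equiv.coe_addRight, add_sub_cancel_right]
      rw [evenChar_add, map_mul]
      calc (rotTwoPointH β h 0 (evenSite r) : ℂ) * (evenChar κ kp q * (conj (evenChar κ kp r) * conj (evenChar κ kp q)))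
          = (rotTwoPointH β h 0 (evenSite r) : ℂ) * conj (evenChar κ kp r) * (evenChar κ kp q * conj (evenChar κ kp q)) := by ring
        _ = _ := by rw [evenChar_mul_conj, mul_one]
    simp only [this, Finset.sum_const, Finset.card_univ, nsmul_eq_mul]
  -- square completion
  have hsq : ∀ σ : SpinConfig (RotSite d'' N),
      (rotWeight β h σ : ℂ) * ((∑ q : Q, evenChar κ kp q * (spinAt (evenSite q) σ : ℂ)) *
        conj (∑ q : Q, evenChar κ kp q * (spinAt (evenSite q) σ : ℂ))) =
      ∑ q : Q, ∑ q' : Q, (rotWeight β h σ : ℂ) * ((spinAt (evenSite q) σ : ℂ) * (spinAt (evenSite q') σ : ℂ)) *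
        (evenChar κ kp q * conj (evenChar κ kp q')) := by
    intro σ
    rw [map_sum, Finset.sum_mul_sum, Finset.mul_sum]
    refine Finset.sum_congr rfl fun q _ => ?_
    rw [Finset.mul_sum]
    refine Finset.sum_congr rfl fun q' _ => ?_
    rw [map_mul, Complex.conj_ofReal]
    ring
  calc (Fintype.card Q : ℂ) * Z * ∑ r : Q, (rotTwoPointH β h 0 (evenSite r) : ℂ) * conj (evenChar κ kp r)
      = Z * ∑ q : Q, ∑ q' : Q, (rotTwoPointH β h 0 (evenSite (q' - q)) : ℂ) * (evenChar κ kp q * conj (evenChar κ kp q')) := by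
        rw [← hsum]; ring
    _ = ∑ q : Q, ∑ q' : Q, ∑ σ : SpinConfig (RotSite d'' N), (rotWeight β h σ : ℂ) *
          ((spinAt (evenSite q) σ : ℂ) * (spinAt (evenSite q') σ : ℂ)) * (evenChar κ kp q * conj (evenChar κ kp q')) := by
        rw [Finset.mul_sum]
        refine Finset.sum_congr rfl fun q _ => ?_
        rw [Finset.mul_sum]
        refine Finset.sum_congr rfl fun q' _ => ?_
        rw [← Finset.sum_mul, sum_rotWeight_mul_spin_mul_spin, rotTwoPointH_eq_zero_sub β h (evenSite q) (evenSite q'),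
          evenSite_sub_evenSite]
        ring
    _ = ∑ σ : SpinConfig (RotSite d'' N), ∑ q : Q, ∑ q' : Q, (rotWeight β h σ : ℂ) *
          ((spinAt (evenSite q) σ : ℂ) * (spinAt (evenSite q') σ : ℂ)) * (evenChar κ kp q * conj (evenChar κ kp q')) := by
        have e1 : ∀ q : Q, ∑ q' : Q, ∑ σ : SpinConfig (RotSite d'' N), (rotWeight β h σ : ℂ) *
            ((spinAt (evenSite q) σ : ℂ) * (spinAt (evenSite q') σ : ℂ)) * (evenChar κ kp q * conj (evenChar κ kp q')) =
            ∑ σ : SpinConfig (RotSite d'' N), ∑ q' : Q, (rotWeight β h σ : ℂ) *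
              ((spinAt (evenSite q) σ : ℂ) * (spinAt (evenSite q') σ : ℂ)) * (evenChar κ kp q * conj (evenChar κ kp q')) :=
          fun q => Finset.sum_comm
        simp only [e1]
        exact Finset.sum_comm
    _ = _ := Finset.sum_congr rfl fun σ _ => (hsq σ).symm

/-- **The diagonal Fourier transform in the transfer representation**:
`N^{d''+1} Z D_N^{(h)}(κ, k⊥) = ∑_{n ∈ ℤ/Nℤ} e(κn) ∑_σ e^{-βH(σ)} Ψ_n(σ) conj Ψ_0(σ)`. [cite: AizenmanDuminilCopinAnnals2021, arXiv:1912.07973 proof of Prop. 5.4 (iii) and Prop. 5.3 (p. 18, Appendix A)] -/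
theorem cardLayer_mul_Z_mul_rotDiagFourierH (β h : ℝ) (κ : ZMod N) (kp : TorusSite (d'' + 1) N) :
    ((Fintype.card (TorusSite (d'' + 1) N) : ℂ) * (isingPartitionFunction (rotGraph d'' N) Finset.univ β h .free : ℂ)) *
      rotDiagFourier (d'' := d'') β h κ kp =
    ∑ n : ZMod N, ZMod.stdAddChar (κ * n) *
      ∑ σ : SpinConfig (RotSite d'' N), (rotWeight β h σ : ℂ) * (evenMode kp σ n * conj (evenMode kp σ 0)) := by
  classical
  have hN0 : (N : ℂ) ≠ 0 := by exact_mod_cast NeZero.ne N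
  have key := card_mul_Z_mul_rotDiagFourierH (d'' := d'') (N := N) β h κ kp
  have hcard : (Fintype.card (ZMod N × TorusSite (d'' + 1) N) : ℂ) = (N : ℂ) * Fintype.card (TorusSite (d'' + 1) N) := by
    rw [Fintype.card_prod, ZMod.card]; push_cast; ring
  rw [hcard] at key
  have hexp : ∀ σ : SpinConfig (RotSite d'' N),
      (∑ m : ZMod N, ZMod.stdAddChar (κ * m) * evenMode kp σ m) * conj (∑ m : ZMod N, ZMod.stdAddChar (κ * m) * evenMode kp σ m) =
      ∑ s : ZMod N, ∑ t : ZMod N, ZMod.stdAddChar (κ * (s - t)) * (evenMode kp σ s * conj (evenMode kp σ t)) := by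
    intro σ
    rw [map_sum, Finset.sum_mul_sum]
    refine Finset.sum_congr rfl fun s _ => Finset.sum_congr rfl fun t _ => ?_
    rw [map_mul (starRingEnd ℂ), ← stdAddChar_mul_conj_eq]
    ring
  have h1 : ∑ σ : SpinConfig (RotSite d'' N), (rotWeight β h σ : ℂ) *
      ((∑ m : ZMod N, ZMod.stdAddChar (κ * m) * evenMode kp σ m) * conj (∑ m : ZMod N, ZMod.stdAddChar (κ * m) * evenMode kp σ m)) =
      ∑ s : ZMod N, ∑ t : ZMod N, ZMod.stdAddChar (κ * (s - t)) *
        ∑ σ : SpinConfig (RotSite d'' N), (rotWeight β h σ : ℂ) * (evenMode kp σ (s - t) * conj (evenMode kp σ 0)) := by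
    simp only [hexp, Finset.mul_sum]
    rw [Finset.sum_comm]
    refine Finset.sum_congr rfl fun s _ => ?_
    rw [Finset.sum_comm]
    refine Finset.sum_congr rfl fun t _ => ?_
    rw [← Finset.mul_sum, ← sum_rotWeight_evenMode_mul_conj β h kp s t, Finset.mul_sum]
    exact Finset.sum_congr rfl fun σ _ => by ring
  have h2 : ∑ s : ZMod N, ∑ t : ZMod N, ZMod.stdAddChar (κ * (s - t)) *
        ∑ σ : SpinConfig (RotSite d'' N), (rotWeight β h σ : ℂ) * (evenMode kp σ (s - t) * conj (evenMode kp σ 0)) =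
      (N : ℂ) * ∑ n : ZMod N, ZMod.stdAddChar (κ * n) *
        ∑ σ : SpinConfig (RotSite d'' N), (rotWeight β h σ : ℂ) * (evenMode kp σ n * conj (evenMode kp σ 0)) := by
    rw [Finset.sum_comm]
    have : ∀ t : ZMod N, ∑ s : ZMod N, ZMod.stdAddChar (κ * (s - t)) *
        ∑ σ : SpinConfig (RotSite d'' N), (rotWeight β h σ : ℂ) * (evenMode kp σ (s - t) * conj (evenMode kp σ 0)) =
        ∑ n : ZMod N, ZMod.stdAddChar (κ * n) *
          ∑ σ : SpinConfig (RotSite d'' N), (rotWeight β h σ : ℂ) * (evenMode kp σ n * conj (evenMode kp σ 0)) :=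
      fun t => Fintype.sum_equiv (Equiv.subRight t) _ _ (fun s => rfl)
    simp only [this, Finset.sum_const, Finset.card_univ, ZMod.card, nsmul_eq_mul]
  rw [h1, h2] at key
  refine mul_left_cancel₀ hN0 ?_
  rw [← key]
  ring

end Fourier

/-! ### Part G. Traces, the spectral profile, and the monotonicity in the diagonal frequency -/

section Spectral

/-- `Ψ_m(σ) = C(R_m) + i S(R_m)` with the cosine / sine layer observables of `TorusTransferSpectral`. [folklore] -/
theorem evenMode_eq (kp : TorusSite (d'' + 1) N) (σ : SpinConfig (RotSite d'' N)) (m : ZMod N) :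
    evenMode kp σ m = (layerObsRe kp (evenLayer σ m) : ℂ) + (layerObsIm kp (evenLayer σ m) : ℂ) * I := by
  rw [evenMode, layerObsRe, layerObsIm]
  push_cast
  rw [Finset.sum_mul, ← Finset.sum_add_distrib]
  refine Finset.sum_congr rfl fun y _ => ?_
  rw [← Complex.re_add_im (torusChar kp y)]
  simp only [Complex.add_re, Complex.ofReal_re, Complex.mul_re, Complex.I_re, mul_zero, Complex.ofReal_im,
    Complex.I_im, mul_one, sub_self, add_zero, Complex.add_im, Complex.mul_im, zero_add]
  ring

/-- **The diagonal layer correlation is a sum of two two-insertion traces** of the symmetrised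
diagonal transfer matrix `A` (the imaginary cross terms cancel by the symmetry of `A`): for `N ≥ 3`,
`∑_σ e^{-βH} Ψ_n conj Ψ_0 = Tr(D_C Aⁿ D_C A^{N-n}) + Tr(D_S Aⁿ D_S A^{N-n})`. [cite: SchultzMattisLieb1964, §II] -/
theorem sum_rotWeight_evenMode_conj_eq_trace (hN : 3 ≤ N) (β h : ℝ) (kp : TorusSite (d'' + 1) N) (n : ZMod N) :
    ∑ σ : SpinConfig (RotSite d'' N), (rotWeight β h σ : ℂ) * (evenMode kp σ n * conj (evenMode kp σ 0)) =
      (((diagonal (layerObsRe kp) * diagTransfer β h ^ n.val * diagonal (layerObsRe kp) * diagTransfer β h ^ (N - n.val)).trace +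
        (diagonal (layerObsIm kp) * diagTransfer β h ^ n.val * diagonal (layerObsIm kp) * diagTransfer β h ^ (N - n.val)).trace : ℝ) : ℂ) := by
  set C := layerObsRe (d' := d'' + 1) kp with hC
  set S := layerObsIm (d' := d'' + 1) kp with hS
  set A := diagTransfer (d'' := d'') (N := N) β h with hA
  have hCC := sum_exp_mul_evenLayerObs_eq_trace hN β h C C n
  have hSS := sum_exp_mul_evenLayerObs_eq_trace hN β h S S n
  have hCS := sum_exp_mul_evenLayerObs_eq_trace hN β h C S n
  have hSC := sum_exp_mul_evenLayerObs_eq_trace hN β h S C n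
  have hsym : (diagonal C * A ^ n.val * diagonal S * A ^ (N - n.val)).trace =
      (diagonal S * A ^ n.val * diagonal C * A ^ (N - n.val)).trace :=
    trace_diagonal_pow_comm (diagTransfer_transpose β h) C S _ _
  have hexp : ∀ σ : SpinConfig (RotSite d'' N),
      (rotWeight β h σ : ℂ) * (evenMode kp σ n * conj (evenMode kp σ 0)) =
        ((rotWeight β h σ * (C (evenLayer σ 0) * C (evenLayer σ n)) +
            rotWeight β h σ * (S (evenLayer σ 0) * S (evenLayer σ n)) : ℝ) : ℂ) +
          ((rotWeight β h σ * (C (evenLayer σ 0) * S (evenLayer σ n)) -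
            rotWeight β h σ * (S (evenLayer σ 0) * C (evenLayer σ n)) : ℝ) : ℂ) * I := by
    intro σ
    rw [evenMode_eq, evenMode_eq, map_add, map_mul (starRingEnd ℂ), Complex.conj_ofReal, Complex.conj_ofReal,
      Complex.conj_I]
    push_cast
    ring_nf
    rw [Complex.I_sq]
    ring
  rw [Finset.sum_congr rfl (fun σ _ => hexp σ), Finset.sum_add_distrib, ← Finset.sum_mul, ← Complex.ofReal_sum,
    ← Complex.ofReal_sum, Finset.sum_add_distrib, Finset.sum_sub_distrib]
  have e1 : ∑ σ : SpinConfig (RotSite d'' N), rotWeight β h σ * (C (evenLayer σ 0) * C (evenLayer σ n)) =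
      (diagonal C * A ^ n.val * diagonal C * A ^ (N - n.val)).trace := hCC
  have e2 : ∑ σ : SpinConfig (RotSite d'' N), rotWeight β h σ * (S (evenLayer σ 0) * S (evenLayer σ n)) =
      (diagonal S * A ^ n.val * diagonal S * A ^ (N - n.val)).trace := hSS
  have e3 : ∑ σ : SpinConfig (RotSite d'' N), rotWeight β h σ * (C (evenLayer σ 0) * S (evenLayer σ n)) =
      (diagonal C * A ^ n.val * diagonal S * A ^ (N - n.val)).trace := hCS
  have e4 : ∑ σ : SpinConfig (RotSite d'' N), rotWeight β h σ * (S (evenLayer σ 0) * C (evenLayer σ n)) =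
      (diagonal S * A ^ n.val * diagonal C * A ^ (N - n.val)).trace := hSC
  rw [e1, e2, e3, e4, hsym, sub_self]
  push_cast
  simp

/-- **The spectral profile of the diagonal Fourier transform** (Aizenman–Duminil-Copin 2021, proof of
Prop. 5.4 (iii): positivity of `TT*` and the spectral representation): for `N ≥ 3`, any `β`, any
field `h` and transverse momentum `k⊥` there is `ρ : ℝ → ℝ`, nonnegative and non-increasing on
`[0, ∞)` (with `u ρ(u)` non-decreasing), such that
`N^{d''+1} Z · D_N^{(h)}(κ, k⊥) = ρ(1 - cos(2πκ/N))` for every `κ`. [cite: AizenmanDuminilCopinAnnals2021, arXiv:1912.07973 proof of Prop. 5.4 (iii) (p. 18)] -/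
theorem exists_rotSpectralProfile (hN : 3 ≤ N) (β h : ℝ) (kp : TorusSite (d'' + 1) N) :
    ∃ ρ : ℝ → ℝ, (∀ u, 0 ≤ u → 0 ≤ ρ u) ∧ (∀ u u', 0 ≤ u → u ≤ u' → ρ u' ≤ ρ u) ∧
      (∀ u u', 0 ≤ u → u ≤ u' → u * ρ u ≤ u' * ρ u') ∧
      ∀ κ : ZMod N,
        ((Fintype.card (TorusSite (d'' + 1) N) : ℂ) * (isingPartitionFunction (rotGraph d'' N) Finset.univ β h .free : ℂ)) *
          rotDiagFourier (d'' := d'') β h κ kp =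
        (ρ (1 - Real.cos (2 * Real.pi * κ.val / N)) : ℂ) := by
  classical
  have hA := diagTransfer_posSemidef (d'' := d'') (N := N) β h
  obtain ⟨evC, cC, hevC, hcC0, hcCsym, hC⟩ := trace_diagonal_pow_diagonal_pow_eq_sum hA (layerObsRe kp)
  obtain ⟨evS, cS, hevS, hcS0, hcSsym, hS⟩ := trace_diagonal_pow_diagonal_pow_eq_sum hA (layerObsIm kp)
  refine ⟨fun u => (1 / 2) * ∑ a, ∑ b, cC a b * pairKernel N (evC a) (evC b) u +
    (1 / 2) * ∑ a, ∑ b, cS a b * pairKernel N (evS a) (evS b) u, ?_, ?_, ?_, ?_⟩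
  · intro u hu
    have h1 : 0 ≤ ∑ a, ∑ b, cC a b * pairKernel N (evC a) (evC b) u :=
      Finset.sum_nonneg fun a _ => Finset.sum_nonneg fun b _ => mul_nonneg (hcC0 a b) (pairKernel_nonneg N (hevC a) (hevC b) hu)
    have h2 : 0 ≤ ∑ a, ∑ b, cS a b * pairKernel N (evS a) (evS b) u :=
      Finset.sum_nonneg fun a _ => Finset.sum_nonneg fun b _ => mul_nonneg (hcS0 a b) (pairKernel_nonneg N (hevS a) (hevS b) hu)
    positivity
  · intro u u' hu huu'
    have h1 : ∑ a, ∑ b, cC a b * pairKernel N (evC a) (evC b) u' ≤ ∑ a, ∑ b, cC a b * pairKernel N (evC a) (evC b) u :=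
      Finset.sum_le_sum fun a _ => Finset.sum_le_sum fun b _ =>
        mul_le_mul_of_nonneg_left (pairKernel_antitone N (hevC a) (hevC b) hu huu') (hcC0 a b)
    have h2 : ∑ a, ∑ b, cS a b * pairKernel N (evS a) (evS b) u' ≤ ∑ a, ∑ b, cS a b * pairKernel N (evS a) (evS b) u :=
      Finset.sum_le_sum fun a _ => Finset.sum_le_sum fun b _ =>
        mul_le_mul_of_nonneg_left (pairKernel_antitone N (hevS a) (hevS b) hu huu') (hcS0 a b)
    linarith
  · intro u u' hu huu'
    have h1 : u * ∑ a, ∑ b, cC a b * pairKernel N (evC a) (evC b) u ≤ u' * ∑ a, ∑ b, cC a b * pairKernel N (evC a) (evC b) u' := by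
      rw [Finset.mul_sum, Finset.mul_sum]
      refine Finset.sum_le_sum fun a _ => ?_
      rw [Finset.mul_sum, Finset.mul_sum]
      refine Finset.sum_le_sum fun b _ => ?_
      have := mul_le_mul_of_nonneg_left (mul_pairKernel_monotone N (hevC a) (hevC b) hu huu') (hcC0 a b)
      nlinarith [this]
    have h2 : u * ∑ a, ∑ b, cS a b * pairKernel N (evS a) (evS b) u ≤ u' * ∑ a, ∑ b, cS a b * pairKernel N (evS a) (evS b) u' := by
      rw [Finset.mul_sum, Finset.mul_sum]
      refine Finset.sum_le_sum fun a _ => ?_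
      rw [Finset.mul_sum, Finset.mul_sum]
      refine Finset.sum_le_sum fun b _ => ?_
      have := mul_le_mul_of_nonneg_left (mul_pairKernel_monotone N (hevS a) (hevS b) hu huu') (hcS0 a b)
      nlinarith [this]
    nlinarith [h1, h2]
  · intro κ
    have hωN : (ZMod.stdAddChar κ : ℂ) ^ N = 1 := stdAddChar_pow_card κ
    have hω1 : ‖(ZMod.stdAddChar κ : ℂ)‖ = 1 := norm_stdAddChar κ
    have hωre : (ZMod.stdAddChar κ : ℂ).re = Real.cos (2 * Real.pi * κ.val / N) := stdAddChar_re κ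
    rw [cardLayer_mul_Z_mul_rotDiagFourierH β h κ kp]
    simp only [sum_rotWeight_evenMode_conj_eq_trace hN β h kp, stdAddChar_mul_eq_pow]
    simp only [hC, hS, Complex.ofReal_add, mul_add, Finset.sum_add_distrib]
    have eC : ∑ n : ZMod N, (ZMod.stdAddChar κ : ℂ) ^ n.val *
        ((∑ a, ∑ b, cC a b * (evC b ^ n.val * evC a ^ (N - n.val)) : ℝ) : ℂ) =
        (((1 / 2 : ℝ) * ∑ a, ∑ b, cC a b * pairKernel N (evC a) (evC b) (1 - (ZMod.stdAddChar κ : ℂ).re) : ℝ) : ℂ) :=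
      (sum_zmod_val_eq_sum_range _).trans (sum_pow_mul_spectralSum_eq hωN hω1 hevC hcCsym)
    have eS : ∑ n : ZMod N, (ZMod.stdAddChar κ : ℂ) ^ n.val *
        ((∑ a, ∑ b, cS a b * (evS b ^ n.val * evS a ^ (N - n.val)) : ℝ) : ℂ) =
        (((1 / 2 : ℝ) * ∑ a, ∑ b, cS a b * pairKernel N (evS a) (evS b) (1 - (ZMod.stdAddChar κ : ℂ).re) : ℝ) : ℂ) :=
      (sum_zmod_val_eq_sum_range _).trans (sum_pow_mul_spectralSum_eq hωN hω1 hevS hcSsym)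
    rw [eC, eS, hωre]

/-- **`D_N(κ, k⊥) ≥ 0`.** For `N ≥ 3`, any `β`. [cite: AizenmanDuminilCopinAnnals2021, arXiv:1912.07973 proof of Prop. 5.4 (iii) (p. 18)] -/
theorem rotDiagFourier_re_nonneg (hN : 3 ≤ N) (β h : ℝ) (κ : ZMod N) (kp : TorusSite (d'' + 1) N) :
    0 ≤ (rotDiagFourier (d'' := d'') β h κ kp).re := by
  obtain ⟨ρ, hρ0, -, -, hrep⟩ := exists_rotSpectralProfile (d'' := d'') hN β h kp
  have hpos : 0 < (Fintype.card (TorusSite (d'' + 1) N) : ℝ) * isingPartitionFunction (rotGraph d'' N) Finset.univ β h .free :=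
    mul_pos (by exact_mod_cast Fintype.card_pos) (isingPartitionFunction_pos _ _ β h _)
  have hre := congrArg Complex.re (hrep κ)
  have hprod : ((Fintype.card (TorusSite (d'' + 1) N) : ℂ) * (isingPartitionFunction (rotGraph d'' N) Finset.univ β h .free : ℂ)) =
      (((Fintype.card (TorusSite (d'' + 1) N) : ℝ) * isingPartitionFunction (rotGraph d'' N) Finset.univ β h .free : ℝ) : ℂ) := by
    push_cast; ring
  rw [hprod, Complex.re_ofReal_mul, Complex.ofReal_re] at hre
  have hu : 0 ≤ 1 - Real.cos (2 * Real.pi * κ.val / N) := by linarith [Real.cos_le_one (2 * Real.pi * κ.val / N)]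
  have := hρ0 _ hu
  rw [← hre] at this
  exact nonneg_of_mul_nonneg_right this hpos

/-- **ADC Prop. 5.4 (iii) on the rotated torus (exact, finite volume): the diagonal Fourier transform
is decreasing in the diagonal frequency.** For the nearest-neighbour Ising model on the rotated torus
`ℤ^{d''+2}/Γ_rot`, `N ≥ 3`, any `β`, any field, every transverse momentum `k⊥` and diagonal frequencies
`κ, κ'` with `cos(2πκ'/N) ≤ cos(2πκ/N)`: `D_N(κ', k⊥) ≤ D_N(κ, k⊥)`. In the lattice dictionary
(`2πκ/N = p₀ + p₁`, `2πk⊥₀/N = p₁ − p₀`) this is the monotone decay of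
`Ŝ^{mod}(p) = Ŝ(p) + Ŝ(p + π(1,1,0,…))` in `|p₀ + p₁|` at fixed `p₀ − p₁` — equivalently, by the
evenness of `Ŝ` in `p₁`, in `|p₀ − p₁|` at fixed `p₀ + p₁`, the form printed by ADC / Panis Prop. 3.16.
[cite: AizenmanDuminilCopinAnnals2021, arXiv:1912.07973 Prop. 5.4 (iii) (p. 18)] [cite: Panis2023Triviality, Prop. 3.16] -/
theorem rotDiagFourier_re_le_of_cos_le (hN : 3 ≤ N) (β h : ℝ) (kp : TorusSite (d'' + 1) N) {κ κ' : ZMod N}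
    (hcos : Real.cos (2 * Real.pi * κ'.val / N) ≤ Real.cos (2 * Real.pi * κ.val / N)) :
    (rotDiagFourier (d'' := d'') β h κ' kp).re ≤ (rotDiagFourier (d'' := d'') β h κ kp).re := by
  obtain ⟨ρ, -, hanti, -, hrep⟩ := exists_rotSpectralProfile (d'' := d'') hN β h kp
  have hpos : 0 < (Fintype.card (TorusSite (d'' + 1) N) : ℝ) * isingPartitionFunction (rotGraph d'' N) Finset.univ β h .free :=
    mul_pos (by exact_mod_cast Fintype.card_pos) (isingPartitionFunction_pos _ _ β h _)
  have hprod : ((Fintype.card (TorusSite (d'' + 1) N) : ℂ) * (isingPartitionFunction (rotGraph d'' N) Finset.univ β h .free : ℂ)) =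
      (((Fintype.card (TorusSite (d'' + 1) N) : ℝ) * isingPartitionFunction (rotGraph d'' N) Finset.univ β h .free : ℝ) : ℂ) := by
    push_cast; ring
  have hre := congrArg Complex.re (hrep κ)
  have hre' := congrArg Complex.re (hrep κ')
  rw [hprod, Complex.re_ofReal_mul, Complex.ofReal_re] at hre hre'
  have hu : 0 ≤ 1 - Real.cos (2 * Real.pi * κ.val / N) := by linarith [Real.cos_le_one (2 * Real.pi * κ.val / N)]
  have hle := hanti _ _ hu (show 1 - Real.cos (2 * Real.pi * κ.val / N) ≤ 1 - Real.cos (2 * Real.pi * κ'.val / N) by linarith)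
  rw [← hre, ← hre'] at hle
  exact le_of_mul_le_mul_left hle hpos

/-- **ADC Prop. 5.4 (iii) on the rotated torus at zero field**, in terms of `rotTwoPoint`:
for `N ≥ 3`, any `β`, `k⊥`, and `cos(2πκ'/N) ≤ cos(2πκ/N)`,
`Re ∑_{m,v} ⟨σ₀σ_{(2m,v+me_b)}⟩^{rot}_β conj(e(κ'm)χ_{k⊥}(v)) ≤ Re ∑_{m,v} ⟨σ₀σ_{(2m,v+me_b)}⟩^{rot}_β conj(e(κm)χ_{k⊥}(v))`.
[cite: AizenmanDuminilCopinAnnals2021, arXiv:1912.07973 Prop. 5.4 (iii) (p. 18)] -/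
theorem rotDiagFourier_zero_re_le_of_cos_le (hN : 3 ≤ N) (β : ℝ) (kp : TorusSite (d'' + 1) N) {κ κ' : ZMod N}
    (hcos : Real.cos (2 * Real.pi * κ'.val / N) ≤ Real.cos (2 * Real.pi * κ.val / N)) :
    (∑ m : ZMod N, ∑ v : TorusSite (d'' + 1) N,
        (rotTwoPoint d'' N β 0 (twoMul m, v + layerShift m) : ℂ) * conj (ZMod.stdAddChar (κ' * m) * torusChar kp v)).re ≤
      (∑ m : ZMod N, ∑ v : TorusSite (d'' + 1) N,
        (rotTwoPoint d'' N β 0 (twoMul m, v + layerShift m) : ℂ) * conj (ZMod.stdAddChar (κ * m) * torusChar kp v)).re :=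
  rotDiagFourier_re_le_of_cos_le (d'' := d'') hN β 0 kp hcos

/-- **`D_N ≥ 0` at zero field**, in terms of `rotTwoPoint`. [cite: AizenmanDuminilCopinAnnals2021, arXiv:1912.07973 proof of Prop. 5.4 (iii) (p. 18)] -/
theorem rotDiagFourier_zero_re_nonneg (hN : 3 ≤ N) (β : ℝ) (κ : ZMod N) (kp : TorusSite (d'' + 1) N) :
    0 ≤ (∑ m : ZMod N, ∑ v : TorusSite (d'' + 1) N,
        (rotTwoPoint d'' N β 0 (twoMul m, v + layerShift m) : ℂ) * conj (ZMod.stdAddChar (κ * m) * torusChar kp v)).re :=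
  rotDiagFourier_re_nonneg (d'' := d'') hN β 0 κ kp

end Spectral

end Literature.Probability.LatticeModels

end
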